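import Summits.ResolutionOfSingularities.ResolutionOfSingularities.Theorems.EquisingularLiftEquisingularLiftSplit
import Summits.ResolutionOfSingularities.ResolutionOfSingularities.Theorems.EquisingularLiftHypersurfacesSuffice
import HarnessLib

/-!
# `EquisingularLift` — STRENGTH CERTIFICATE (lower bound of the crux stmt-ResolutionOfSingularities-15660)

Kernel-checked calibration of the crux `Theses.EquisingularLift.EquisingularLift` (EL) for the tribunal / planners
(BC5 "witness of weakness", BC9 "ladder ceiling"), extracted from the route's deciding theorem `closes` and the
PROVED crux `HypersurfacesSuffice` (`Theorems.HypersurfacesSuffice.HypersurfacesSuffice_of`):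

* `hasResolution_of_chain` — the geometric heart of `closes`, stated once for every line of this crux: if an integral
  `H` sits in a locally Noetherian `P` as a closed subscheme and `(P', σ, S')` is reached from `(P, 𝟙, range ι₀)` by the
  recursor-encoded chain of blow-ups in regular centres off the generic point (`Split.Chain`), and the reduced closed
  subscheme on `closure S'` is regular, then `H` has a resolution of singularities (the reduced strict transform maps
  properly and birationally onto `H`). No `O`, no smoothness, no irreducibility of special fibres is used.
* `hasResolution_hypersurface_of_equisingularLift` — EL ⟹ every integral hypersurface of `ℙᵐ` over every
  algebraically closed field of characteristic `p > 0` has a resolution.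
* `resolutionOverAlgClosed_of_equisingularLift` — EL ⟹ resolution of EVERY reduced separated scheme of finite type
  over EVERY algebraically closed field of positive characteristic (with `HypersurfacesSuffice_of`). In words: the crux
  is at least as strong as the summit restricted to algebraically closed ground fields, in all dimensions; the route's
  remaining content beyond EL is exactly the two Descent cruxes (`closes hEL HypersurfacesSuffice_of`).

These are consequences OF the crux (calibration), not progress toward it; they make precise, in the kernel, the
refuters' verdict "summit-core-or-harder" (ATTACK.md, Disproof.lean §1 "Sandwich (lower)").
-/

set_option linter.dupNamespace false -- mandated namespace `Summit.<Summit>.<Problem>` of this single-conjunct summit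

noncomputable section

open CategoryTheory AlgebraicGeometry TopologicalSpace Topology
open Literature.AlgebraicGeometry.Resolution
open AlgebraicGeometry.Scheme.IdealSheafData
open Summit.ResolutionOfSingularities.ResolutionOfSingularities.Theses.EquisingularLift
open Summit.ResolutionOfSingularities.ResolutionOfSingularities.Theses.EquisingularLift.Split

namespace Summit.ResolutionOfSingularities.ResolutionOfSingularities.Theorems.EquisingularLift

/-- **The reduced iterated strict transform resolves.** Let `H` be integral, `ι₀ : H ⟶ P` a closed immersion into a
locally Noetherian scheme, and `(P', σ, S')` reached from `(P, 𝟙, range ι₀)` by a `Split.Chain` (finitely many blow-ups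
in regular centres whose images avoid the generic point of `range ι₀`, `S'` the iterated strict transform). If the
reduced closed subscheme on `closure S'` is regular, then `H` has a resolution of singularities: `σ` is proper and an
isomorphism over an open `V` containing the generic point, `S' = closure {ξ'}` for the unique `ξ'` over it, and
`V(closure S') → H` (through `IsClosedImmersion.lift`) is proper and birational with regular source. This is the argument
of `Theses.EquisingularLift.closes` (and of `Literature…hasResolution_of_isEmbeddedTransform`), isolated. [folklore] -/
theorem hasResolution_of_chain : ∀ (P P' H : AlgebraicGeometry.Scheme.{0}) [AlgebraicGeometry.IsLocallyNoetherian P] [AlgebraicGeometry.IsIntegral H] (ι₀ : H ⟶ P) [AlgebraicGeometry.IsClosedImmersion ι₀] (σ : P' ⟶ P) (S' : Set P'), Summit.ResolutionOfSingularities.ResolutionOfSingularities.Theses.EquisingularLift.Split.Chain P (Set.range ι₀) P' σ S' → Literature.AlgebraicGeometry.Resolution.Scheme.IsRegular (AlgebraicGeometry.Scheme.IdealSheafData.vanishingIdeal (⟨closure S', isClosed_closure⟩ : TopologicalSpace.Closeds P')).subscheme → Literature.AlgebraicGeometry.Resolution.Scheme.HasResolution H := by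
  intro P P' H _ _ ι₀ _ σ S' hch hreg
  classical
  have hYcl : IsClosed (Set.range ι₀) := ι₀.isClosedEmbedding.isClosed_range
  have hgen : IsGenericPoint (ι₀ (genericPoint H)) (Set.range ι₀) := by
    have h := (genericPoint_spec H).image ι₀.continuous
    rwa [Set.image_univ, hYcl.closure_eq] at h
  set ξ : P := ι₀ (genericPoint H) with hξdef
  have hYξ : Set.range ι₀ = closure {ξ} := hgen.symm
  have hT : ξ ∉ {x : P | ¬ IsGenericPoint x (Set.range ι₀)} := by
    simp only [Set.mem_setOf_eq, not_not]
    exact hgen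
  have hstruct : IsProper σ ∧ ∃ V : P.Opens,
      {x : P | ¬ IsGenericPoint x (Set.range ι₀)}ᶜ ⊆ (V : Set P) ∧ IsIso (σ ∣_ V) ∧
        ∃ ξ' : P', σ ξ' = ξ ∧ S' = closure {ξ'} := by
    refine hch (fun X' σ' Y' => IsProper σ' ∧ ∃ V : P.Opens,
      {x : P | ¬ IsGenericPoint x (Set.range ι₀)}ᶜ ⊆ (V : Set P) ∧ IsIso (σ' ∣_ V) ∧
        ∃ ξ' : X', σ' ξ' = ξ ∧ Y' = closure {ξ'}) ?_ ?_
    · -- no blow-up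
      refine ⟨inferInstance, ⊤, by simp, ?_, ξ, rfl, hYξ⟩
      infer_instance
    · -- one more blow-up `τ : X'' ⟶ X'` along `C`, regular centre whose image avoids `ξ`
      intro X' X'' σ' Y' C τ hQ hτ _ hTC
      obtain ⟨hσ', V, hTV, hiso, ξ', hξ', hY'⟩ := hQ
      haveI := hσ'
      haveI : IsLocallyNoetherian X' := LocallyOfFiniteType.isLocallyNoetherian σ'
      haveI : IsProper τ := hτ.isProper
      have hclosed : IsClosed (σ' '' (C.support : Set X')) :=
        σ'.isClosedMap _ C.support.isClosed
      let V' : P.Opens := V ⊓ ⟨(σ' '' (C.support : Set X'))ᶜ, hclosed.isOpen_compl⟩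
      have hV'V : V' ≤ V := inf_le_left
      have hTV' : {x : P | ¬ IsGenericPoint x (Set.range ι₀)}ᶜ ⊆ (V' : Set P) :=
        fun x hx => ⟨hTV hx, fun hx' => hx (hTC hx')⟩
      let Wc : X'.Opens := ⟨(C.support : Set X')ᶜ, C.support.isClosed.isOpen_compl⟩
      have hWc : IsIso (τ ∣_ Wc) := hτ.isIso_morphismRestrict disjoint_compl_left
      have hle : (Opens.map σ'.base).obj V' ≤ Wc := fun x hx hxC => hx.2 ⟨x, hxC, rfl⟩
      have hiso' : IsIso ((CategoryStruct.comp τ σ') ∣_ V') := by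
        rw [morphismRestrict_comp]
        have i1 := isIso_morphismRestrict_of_le σ' hiso hV'V
        have i2 := isIso_morphismRestrict_of_le τ hWc hle
        exact @IsIso.comp_isIso _ _ _ _ _ _ _ i2 i1
      have hξ'C : ξ' ∉ (C.support : Set X') := fun h' => hT (hTC ⟨ξ', h', hξ'⟩)
      obtain ⟨ξ₂, hξ₂, huniq⟩ := existsUnique_preimage τ hWc (y := ξ') hξ'C
      have hfib : τ ⁻¹' {ξ'} = {ξ₂} := by
        ext z
        simp only [Set.mem_preimage, Set.mem_singleton_iff]
        exact ⟨fun hz => huniq z hz, fun hz => hz ▸ hξ₂⟩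
      refine ⟨inferInstance, V', hTV', hiso', ξ₂,
        by rw [Scheme.Hom.comp_apply, hξ₂, hξ'], ?_⟩
      apply le_antisymm
      · refine closure_minimal ?_ isClosed_closure
        rintro x ⟨hxY, hxC⟩
        rw [hY'] at hxY
        have hx := preimage_closure_inter_subset τ hWc {ξ'} ⟨hxY, hxC⟩
        rwa [hfib] at hx
      · refine closure_mono (Set.singleton_subset_iff.mpr ?_)
        refine ⟨?_, ?_⟩
        · rw [hY']
          show τ ξ₂ ∈ closure {ξ'}
          rw [hξ₂]
          exact subset_closure rfl
        · show τ ξ₂ ∉ (C.support : Set X')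
          rw [hξ₂]
          exact hξ'C
  obtain ⟨hσ, V, hTV, hiso, ξ', hξ', hY'⟩ := hstruct
  haveI := hσ
  set Z : Closeds P' := ⟨closure S', isClosed_closure⟩ with hZdef
  have hZ : (Z : Set P') = closure {ξ'} := by
    change closure S' = closure {ξ'}
    rw [hY', closure_closure]
  let j := (vanishingIdeal Z).subschemeι
  haveI : IsIntegral (vanishingIdeal Z).subscheme :=
    ComponentGluing.isIntegral_subscheme_vanishingIdeal Z (hZ ▸ isIrreducible_singleton.closure)
  have hrangej : Set.range j = closure {ξ'} := by
    rw [range_subschemeι, coe_support_vanishingIdeal, hZ]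
  have hker : ι₀.ker ≤ (CategoryStruct.comp j σ).ker := by
    have e1 : (CategoryStruct.comp j σ).ker = vanishingIdeal (.closure (σ '' (Z : Set P'))) := by
      rw [← map_vanishingIdeal]
      rfl
    rw [e1, ← le_support_iff_le_vanishingIdeal]
    have e2 : (ι₀.ker.support : Set P) = Set.range ι₀ := by
      rw [Scheme.Hom.support_ker, hYcl.closure_eq]
    rw [← SetLike.coe_subset_coe, e2, Closeds.closure]
    change closure (σ '' (Z : Set P')) ⊆ Set.range ι₀
    rw [hYξ, hZ]
    refine closure_minimal ((image_closure_subset_closure_image σ.continuous).trans ?_)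
      isClosed_closure
    rw [Set.image_singleton, hξ']
  let ρ : (vanishingIdeal Z).subscheme ⟶ H := IsClosedImmersion.lift ι₀ (CategoryStruct.comp j σ) hker
  have hρ : CategoryStruct.comp ρ ι₀ = CategoryStruct.comp j σ :=
    IsClosedImmersion.lift_fac ι₀ (CategoryStruct.comp j σ) hker
  have hρapp : ∀ y, ι₀ (ρ y) = σ (j y) := fun y => by
    rw [← Scheme.Hom.comp_apply, hρ, Scheme.Hom.comp_apply]
  haveI : IsProper ρ := by
    have hc : IsProper (CategoryStruct.comp ρ ι₀) := by rw [hρ]; infer_instance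
    exact MorphismProperty.of_postcomp (W := @AlgebraicGeometry.IsProper)
      (W' := @AlgebraicGeometry.IsSeparated) ρ ι₀ inferInstance hc
  let U : H.Opens := (Opens.map ι₀.base).obj V
  have hξV : ξ ∈ V := hTV hT
  have hηU : genericPoint H ∈ U := hξV
  obtain ⟨y₀, hy₀⟩ : ξ' ∈ Set.range j := by
    rw [hrangej]
    exact subset_closure rfl
  have hfibξ : σ ⁻¹' {ξ} = {ξ'} := by
    obtain ⟨x, -, huniq⟩ := existsUnique_preimage σ hiso hξV
    ext z
    simp only [Set.mem_preimage, Set.mem_singleton_iff]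
    exact ⟨fun hz => (huniq z hz).trans (huniq ξ' hξ').symm, fun hz => hz ▸ hξ'⟩
  have hover : ∀ x : P', σ x ∈ Set.range ι₀ → σ x ∈ V → x ∈ closure {ξ'} := by
    intro x hx hxV
    rw [hYξ] at hx
    have hx' := preimage_closure_inter_subset σ hiso {ξ} ⟨hx, hxV⟩
    rwa [hfibξ] at hx'
  have hbir : IsBirational ρ := by
    refine ⟨U, ?_, ?_, ?_⟩
    · have hd : Dense ({genericPoint H} : Set H) := by
        rw [dense_iff_closure_eq]
        exact genericPoint_spec H
      exact hd.mono (Set.singleton_subset_iff.mpr hηU)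
    · have hgen' : closure ({y₀} : Set (vanishingIdeal Z).subscheme) = Set.univ := by
        rw [j.isClosedEmbedding.isInducing.closure_eq_preimage_closure_image,
          Set.image_singleton, hy₀, ← hrangej, Set.preimage_range]
      have hd : Dense ({y₀} : Set (vanishingIdeal Z).subscheme) := by
        rw [dense_iff_closure_eq]
        exact hgen'
      refine hd.mono (Set.singleton_subset_iff.mpr ?_)
      change ι₀ (ρ y₀) ∈ V
      rw [hρapp, hy₀, hξ']
      exact hξV
    · haveI : IsClosedImmersion (ρ ∣_ U) := by
        have i1 : IsClosedImmersion ((CategoryStruct.comp j σ) ∣_ V) := by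
          rw [morphismRestrict_comp]
          haveI := hiso
          exact (MorphismProperty.cancel_right_of_respectsIso
            @AlgebraicGeometry.IsClosedImmersion _ _).mpr
            (IsZariskiLocalAtTarget.restrict (inferInstanceAs (IsClosedImmersion j)) _)
        rw [← hρ, morphismRestrict_comp] at i1
        exact MorphismProperty.of_postcomp (W := @AlgebraicGeometry.IsClosedImmersion)
          (W' := @AlgebraicGeometry.IsSeparated) (ρ ∣_ U) (ι₀ ∣_ V) inferInstance i1
      haveI : AlgebraicGeometry.Surjective (ρ ∣_ U) := by
        refine ⟨fun u => ?_⟩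
        have hu : ι₀ u.1 ∈ V := u.2
        obtain ⟨x, hx, -⟩ := existsUnique_preimage σ hiso hu
        have hxZ : x ∈ Set.range j := by
          rw [hrangej]
          exact hover x (hx ▸ Set.mem_range_self _) (hx ▸ hu)
        obtain ⟨y₁, rfl⟩ := hxZ
        have hρy₁ : ρ y₁ = u.1 := ι₀.isClosedEmbedding.injective (by rw [hρapp, hx])
        refine ⟨⟨y₁, show ρ y₁ ∈ U by rw [hρy₁]; exact u.2⟩, Subtype.ext ?_⟩
        rw [morphismRestrict_base_coe]
        exact hρy₁
      exact isIso_of_isClosedImmersion_of_surjective _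
  exact ⟨_, ρ, ⟨inferInstance, hbir, hreg⟩⟩

/-- **EL resolves hypersurfaces.** `EquisingularLift` implies: over every algebraically closed field `k` of
characteristic `p > 0`, every integral closed `H ⊆ ℙᵐ_k` with locally principal ideal has a resolution of
singularities (take the data of EL; `Y ≅ H` embeds `H` in the locally Noetherian `P` with range `Y`; apply
`hasResolution_of_chain`). [folklore] -/
theorem hasResolution_hypersurface_of_equisingularLift (hEL : EquisingularLift) :
    ∀ p : ℕ, p.Prime → ∀ (k : Type) [Field k] [CharP k p] [IsAlgClosed k] (m : ℕ) (H : Scheme.{0})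
      (ι' : H ⟶ (Literature.AlgebraicGeometry.Motives.projectiveSpace m k).left),
      IsClosedImmersion ι' → IsIntegral H →
      (∀ y : (Literature.AlgebraicGeometry.Motives.projectiveSpace m k).left,
        ∃ U : (Literature.AlgebraicGeometry.Motives.projectiveSpace m k).left.affineOpens,
          y ∈ (U : (Literature.AlgebraicGeometry.Motives.projectiveSpace m k).left.Opens) ∧
            (ι'.ker.ideal U).IsPrincipal) →
      Scheme.HasResolution H := by
  intro p hp k _ _ _ m H ι' hι' hH hprinc
  obtain ⟨O, _, _, _, _, P, P', q, Y, σ, S', hq, _, _, ⟨e⟩, hET, _, hreg⟩ :=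
    hEL p hp k m H ι' hι' hH hprinc
  haveI := hq
  haveI := hH
  haveI : IsLocallyNoetherian P := LocallyOfFiniteType.isLocallyNoetherian q
  let ι₀ : H ⟶ P := CategoryStruct.comp e.inv (vanishingIdeal Y).subschemeι
  haveI : IsClosedImmersion ι₀ := inferInstance
  have hrange : Set.range ι₀ = (Y : Set P) := by
    rw [← coe_support_vanishingIdeal Y, ← range_subschemeι]
    ext x
    constructor
    · rintro ⟨h, rfl⟩
      exact ⟨e.inv h, (Scheme.Hom.comp_apply _ _ h).symm⟩
    · rintro ⟨y, rfl⟩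
      obtain ⟨h, rfl⟩ := e.inv.surjective y
      exact ⟨h, Scheme.Hom.comp_apply _ _ h⟩
  have hch : Chain P (Set.range ι₀) P' σ S' := by
    rw [hrange]
    exact hET
  exact hasResolution_of_chain P P' H ι₀ σ S' hch hreg

/-- **STRENGTH CERTIFICATE.** `EquisingularLift` implies resolution of singularities of EVERY reduced separated
scheme of finite type over EVERY algebraically closed field of positive characteristic, in all dimensions — the summit
restricted to algebraically closed ground fields — via the proved crux `HypersurfacesSuffice`
(`Theorems.HypersurfacesSuffice.HypersurfacesSuffice_of`). [folklore] -/
theorem resolutionOverAlgClosed_of_equisingularLift (hEL : EquisingularLift) :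
    ∀ p : ℕ, p.Prime → ∀ (k : Type) [Field k] [CharP k p] [IsAlgClosed k] (X : Scheme.{0})
      (f : X ⟶ Spec (.of k)), IsSeparated f → LocallyOfFiniteType f → QuasiCompact f → IsReduced X →
      Scheme.HasResolution X := by
  intro p hp k _ _ _ X f h1 h2 h3 h4
  exact Theorems.HypersurfacesSuffice.HypersurfacesSuffice_of k
    (fun m H ι' hι' hH hprinc =>
      hasResolution_hypersurface_of_equisingularLift hEL p hp k m H ι' hι' hH hprinc) X f h1 h2 h3 h4

end Summit.ResolutionOfSingularities.ResolutionOfSingularities.Theorems.EquisingularLift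

end
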